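import Summits.ResolutionOfSingularities.ResolutionOfSingularities.Theses.FrobeniusLadder
import Summits.ResolutionOfSingularities.ResolutionOfSingularities.Theorems.FrobeniusLadderFInjectiveMacaulayficationThreefoldIdentities
import Summits.ResolutionOfSingularities.ResolutionOfSingularities.Theorems.FrobeniusLadderFInjectiveMacaulayficationThreefoldChart3Points
import Summits.ResolutionOfSingularities.ResolutionOfSingularities.Theorems.FrobeniusLadderFInjectiveMacaulayficationThreefoldOriginNotClause
import Mathlib.Algebra.MvPolynomial.PDeriv
import Mathlib.Algebra.CharP.Two
import HarnessLib

/-!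
# The Fedder flip, polynomial level: `f` fails Fedder's test, its strict transform `g` passes it

Support file for crux stmt-ResolutionOfSingularities-15315 (`FrobeniusLadder.FInjectiveMacaulayfication`,
line `Sketch`): stub `stub_threefoldStrictTransformFedder` of the THREEFOLD CALIBRATION (dimension `3`,
characteristic `2`) and, riding along, the route's support item `ThreefoldStrictTransformFedder`
(stmt-ResolutionOfSingularities-17937) verbatim (`threefoldStrictTransformFedder_proof`).

Let `k` be a field of characteristic `2`, `S = k[X₀, X₁, X₂, X₃]`,
`f = X₀²X₁ + X₁²X₂ + X₂²X₀ + X₀X₃³ + X₁X₂X₃²` and `g = X₀²X₁ + X₁²X₂ + X₂²X₀ + X₀X₃ + X₁X₂X₃` (the strict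
transform of `f` on the `X₃`-chart of the blow-up of the origin; multiplicity `3`). We prove:

1. `f ∈ (X₀², X₁², X₂², X₃²)` — Fedder's test FAILS at the input point
   (`ThreefoldOriginNotClause.threefold_mem_frobeniusSpan`);
2. `θ₃ f = X₃³ · g` for `θ₃ : X₃ ↦ X₃, Xⱼ ↦ Xⱼ X₃ (j ≠ 3)` (the chart identity, last conjunct group of
   `ThreefoldIdentities.stub_threefoldIdentities`);
3. `g ∉ (X₀², X₁², X₂², X₃²)` — Fedder's test PASSES at the origin of the chart
   (`ThreefoldChart3Points.g3_notMem`, exponent `2 - 1 = 1`);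
4. `g ∈ (X₀, X₁, X₂, X₃)²` — the new point is singular (`g3_mem_span_range_X_sq`: every monomial of `g`
   is a product of at least two variables);
5. `∂₁g - X₀², ∂₂g - X₁², ∂₀g - X₂² ∈ (X₃)` — the Jacobian certificates along the exceptional divisor
   (`g3_jacobian_certificates`: by `ThreefoldChart3Points.pderiv_one_g3` etc. the differences are
   `2X₁X₂ + X₂X₃`, `2X₂X₀ + X₁X₃`, `2X₀X₁ + X₃`, and `2 = 0` in `S`).

References: R. Fedder, *F-purity and rational singularity*, Trans. AMS 278 (1983), Prop. 1.7 and
Thm. 1.12 [Fedder1983] (the test `g^(p-1) ∉ 𝔪^[p]`, through the imported files). The computation itself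
is folklore.
-/

-- single-problem summit: the doubled namespace component is forced
set_option linter.dupNamespace false

namespace Summit.ResolutionOfSingularities.ResolutionOfSingularities.Theorems.FInjectiveMacaulayfication.ThreefoldStrictTransformFedder

open MvPolynomial
open Summit.ResolutionOfSingularities.ResolutionOfSingularities.Theorems.FInjectiveMacaulayfication

/-- **The new point is singular:** `g = X₀²X₁ + X₁²X₂ + X₂²X₀ + X₀X₃ + X₁X₂X₃ ∈ (X₀, X₁, X₂, X₃)²` over any
commutative ring — every monomial of `g` is a multiple of a product `XᵢXⱼ ∈ (X)·(X) = (X)²`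
(`Ideal.mul_mem_mul`, `pow_two`). [folklore] -/
theorem g3_mem_span_range_X_sq (k : Type) [CommRing k] :
    (X 0 ^ 2 * X 1 + X 1 ^ 2 * X 2 + X 2 ^ 2 * X 0 + X 0 * X 3 + X 1 * X 2 * X 3 :
        MvPolynomial (Fin 4) k) ∈
      Ideal.span (Set.range (X : Fin 4 → MvPolynomial (Fin 4) k)) ^ 2 := by
  have hX : ∀ i : Fin 4, (X i : MvPolynomial (Fin 4) k) ∈
      Ideal.span (Set.range (X : Fin 4 → MvPolynomial (Fin 4) k)) :=
    fun i => Ideal.subset_span ⟨i, rfl⟩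
  have hXX : ∀ i j : Fin 4, (X i * X j : MvPolynomial (Fin 4) k) ∈
      Ideal.span (Set.range (X : Fin 4 → MvPolynomial (Fin 4) k)) ^ 2 := fun i j => by
    rw [pow_two]
    exact Ideal.mul_mem_mul (hX i) (hX j)
  have h : (X 0 ^ 2 * X 1 + X 1 ^ 2 * X 2 + X 2 ^ 2 * X 0 + X 0 * X 3 + X 1 * X 2 * X 3 :
        MvPolynomial (Fin 4) k) =
      X 1 * (X 0 * X 0) + X 2 * (X 1 * X 1) + X 0 * (X 2 * X 2) + X 0 * X 3 + X 1 * (X 2 * X 3) := by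
    ring
  rw [h]
  exact add_mem (add_mem (add_mem (add_mem (Ideal.mul_mem_left _ _ (hXX 0 0))
    (Ideal.mul_mem_left _ _ (hXX 1 1))) (Ideal.mul_mem_left _ _ (hXX 2 2))) (hXX 0 3))
    (Ideal.mul_mem_left _ _ (hXX 2 3))

/-- **Jacobian certificates along the exceptional divisor, characteristic `2`:** for
`g = X₀²X₁ + X₁²X₂ + X₂²X₀ + X₀X₃ + X₁X₂X₃` over a commutative ring of characteristic `2`,
`∂₁g - X₀² = X₂X₃`, `∂₂g - X₁² = X₁X₃` and `∂₀g - X₂² = X₃` (the terms `2X₁X₂`, `2X₂X₀`, `2X₀X₁` of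
`ThreefoldChart3Points.pderiv_one_g3` / `pderiv_two_g3` / `pderiv_zero_g3` vanish), so all three
differences lie in `(X₃)`. [folklore] -/
theorem g3_jacobian_certificates (k : Type) [CommRing k] [CharP k 2] (g : MvPolynomial (Fin 4) k)
    (hg : g = X 0 ^ 2 * X 1 + X 1 ^ 2 * X 2 + X 2 ^ 2 * X 0 + X 0 * X 3 + X 1 * X 2 * X 3) :
    pderiv 1 g - X 0 ^ 2 ∈ Ideal.span {(X 3 : MvPolynomial (Fin 4) k)} ∧
      pderiv 2 g - X 1 ^ 2 ∈ Ideal.span {(X 3 : MvPolynomial (Fin 4) k)} ∧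
      pderiv 0 g - X 2 ^ 2 ∈ Ideal.span {(X 3 : MvPolynomial (Fin 4) k)} := by
  -- `2 = 0` in `S = k[X₀, X₁, X₂, X₃]`
  have h2 : (2 : MvPolynomial (Fin 4) k) = 0 := by
    rw [show (2 : MvPolynomial (Fin 4) k) = C (2 : k) from (map_ofNat C 2).symm,
      CharP.ofNat_eq_zero k 2, map_zero]
  subst hg
  refine ⟨Ideal.mem_span_singleton.mpr ⟨X 2, ?_⟩, Ideal.mem_span_singleton.mpr ⟨X 1, ?_⟩,
    Ideal.mem_span_singleton.mpr ⟨1, ?_⟩⟩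
  · rw [ThreefoldChart3Points.pderiv_one_g3, h2]
    ring
  · rw [ThreefoldChart3Points.pderiv_two_g3, h2]
    ring
  · rw [ThreefoldChart3Points.pderiv_zero_g3, h2]
    ring

/-- **THE FEDDER FLIP, polynomial level** (stub `stub_threefoldStrictTransformFedder` of crux
stmt-ResolutionOfSingularities-15315, line `Sketch`; = route item `ThreefoldStrictTransformFedder`): for
every field `k` of characteristic `2`, `f = X₀²X₁ + X₁²X₂ + X₂²X₀ + X₀X₃³ + X₁X₂X₃²` and
`g = X₀²X₁ + X₁²X₂ + X₂²X₀ + X₀X₃ + X₁X₂X₃` in `k[X₀, …, X₃]`: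
(i) `f ∈ (X₀², X₁², X₂², X₃²)` — Fedder's test fails at the input point
(`ThreefoldOriginNotClause.threefold_mem_frobeniusSpan`);
(ii) `θ₃ f = X₃³ · g` — `g` is the strict transform of `f` on the `X₃`-chart
(`ThreefoldIdentities.stub_threefoldIdentities`);
(iii) `g ∉ (X₀², …, X₃²)` — Fedder's test passes at the origin of the chart
(`ThreefoldChart3Points.g3_notMem`);
(iv) `g ∈ (X₀, …, X₃)²` — the new point is singular (`g3_mem_span_range_X_sq`);
(v) `∂₁g - X₀², ∂₂g - X₁², ∂₀g - X₂² ∈ (X₃)` — Jacobian certificates (`g3_jacobian_certificates`).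
[cite: Fedder1983, Prop. 1.7 and Thm. 1.12] -/
theorem stub_threefoldStrictTransformFedder : ∀ (k : Type) [Field k] [CharP k 2] (f g : MvPolynomial (Fin 4) k),
    f = MvPolynomial.X 0 ^ 2 * MvPolynomial.X 1 + MvPolynomial.X 1 ^ 2 * MvPolynomial.X 2 + MvPolynomial.X 2 ^ 2 * MvPolynomial.X 0 + MvPolynomial.X 0 * MvPolynomial.X 3 ^ 3 + MvPolynomial.X 1 * MvPolynomial.X 2 * MvPolynomial.X 3 ^ 2 →
    g = MvPolynomial.X 0 ^ 2 * MvPolynomial.X 1 + MvPolynomial.X 1 ^ 2 * MvPolynomial.X 2 + MvPolynomial.X 2 ^ 2 * MvPolynomial.X 0 + MvPolynomial.X 0 * MvPolynomial.X 3 + MvPolynomial.X 1 * MvPolynomial.X 2 * MvPolynomial.X 3 →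
    f ∈ Ideal.span (Set.range fun i : Fin 4 => (MvPolynomial.X i : MvPolynomial (Fin 4) k) ^ 2) ∧
    MvPolynomial.aeval (fun j : Fin 4 => if j = 3 then (MvPolynomial.X 3 : MvPolynomial (Fin 4) k) else MvPolynomial.X j * MvPolynomial.X 3) f = MvPolynomial.X 3 ^ 3 * g ∧
    g ∉ Ideal.span (Set.range fun i : Fin 4 => (MvPolynomial.X i : MvPolynomial (Fin 4) k) ^ 2) ∧
    g ∈ Ideal.span (Set.range (MvPolynomial.X : Fin 4 → MvPolynomial (Fin 4) k)) ^ 2 ∧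
    (MvPolynomial.pderiv 1 g - MvPolynomial.X 0 ^ 2 ∈ Ideal.span {(MvPolynomial.X 3 : MvPolynomial (Fin 4) k)} ∧
      MvPolynomial.pderiv 2 g - MvPolynomial.X 1 ^ 2 ∈ Ideal.span {(MvPolynomial.X 3 : MvPolynomial (Fin 4) k)} ∧
      MvPolynomial.pderiv 0 g - MvPolynomial.X 2 ^ 2 ∈ Ideal.span {(MvPolynomial.X 3 : MvPolynomial (Fin 4) k)}) := by
  intro k _ _ f g hf hg
  refine ⟨?_, ?_, ?_, ?_, g3_jacobian_certificates k g hg⟩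
  · -- (i) Fedder's test fails for `f`
    rw [hf]
    exact ThreefoldOriginNotClause.threefold_mem_frobeniusSpan k
  · -- (ii) the chart identity `θ₃ f = X₃³ g`
    exact (ThreefoldIdentities.stub_threefoldIdentities k f _ _ _ g hf rfl rfl rfl hg).2.2.2.2.2.1
  · -- (iii) Fedder's test passes for `g` (exponent `2 - 1 = 1`)
    have h := ThreefoldChart3Points.g3_notMem k
    rw [show (2 - 1 : ℕ) = 1 from rfl, pow_one] at h
    rw [hg]
    exact h
  · -- (iv) the new point is singular
    rw [hg]
    exact g3_mem_span_range_X_sq k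

/-- **Route item `ThreefoldStrictTransformFedder` (stmt-ResolutionOfSingularities-17937), verbatim** — the
Fedder flip at polynomial level, riding along with the registered stub: the two `let`s of the route
declaration are introduced and discharged by `stub_threefoldStrictTransformFedder` with `rfl, rfl`.
[cite: Fedder1983, Prop. 1.7 and Thm. 1.12] -/
theorem threefoldStrictTransformFedder_proof :
    Summit.ResolutionOfSingularities.ResolutionOfSingularities.Theses.FrobeniusLadder.ThreefoldStrictTransformFedder := by
  intro k _ _ f g
  exact stub_threefoldStrictTransformFedder k f g rfl rfl

end Summit.ResolutionOfSingularities.ResolutionOfSingularities.Theorems.FInjectiveMacaulayfication.ThreefoldStrictTransformFedder
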